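import Mathlib
import Summits.AtomisticToContinuum.FouriersLaw.Theorems.EmbeddedDrudeMourreMourreDissolutionFormFiniteSmooth
import Summits.AtomisticToContinuum.FouriersLaw.Theorems.EmbeddedDrudeMourreMourreDissolutionBracketModulus
import HarnessLib

/-!
# Uniform domination of the fibre Poisson integrals — `stub_fibreDomination` (stub DOM) of line
`swap-odd-threshold-rigidity` (crux `EmbeddedDrudeMourre.MourreDissolution`, item
stmt-AtomisticToContinuum-12594; helper file, `--supports`)

Registered stub DOM of the checked skeleton of line `swap-odd-threshold-rigidity` (lead c8), in the
skeleton's stub namespace `Summit.AtomisticToContinuum.FouriersLaw.Theorems.MourreDissolution`,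
registered in the shape `TZ → BM → DOM`: the uniform TWO-ZERO FLOOR of the resonance function along its
`k₂`-fibres (TZ: for `ω₂ > 0` some `m > 0` such that on every non-degenerate fibre there is `kt` with
`m·|sin((k₃−k₁)/2) sin((k₂−k₃)/2) sin((k₂−kt)/2)| ≤ |Ω(k₁,k₂,k₃)|` for all real `k₂`) and the BRACKET
MODULUS of a `2π`-periodic `C²` profile (BM: `|[f]| ≤ K·|sin((k₃−k₁)/2) sin((k₂−k₃)/2)|`) are taken as
HYPOTHESES (they are other stubs of the skeleton; neither is restated or reproved here), and the
conclusion is: for `ω₂ > 0`, couplings `a, b` and a `2π`-periodic `C²` profile `f` there is `M` with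
`∫_{(−π,π]} Φ²(∏ω)⁻²[f]²·ν/(Ω²+ν²) dk₂ ≤ M` for every non-degenerate fibre `(k₁, k₃)` of the cell and
every `ν > 0` (`Φ = vertex a b`, `ω = dispersion ω₂ ≥ √ω₂`, `Ω = resonanceFn ω₂`).

Proof (elementary real analysis, no cited facts). Fix `ω₂, a, b, f`; take `m` from TZ and `K` from BM
and put `C = (|a|+16|b|)² ω₂⁻⁴ K²`, `M = C·π²/m`. Fix a non-degenerate fibre, `s_p = sin((k₃−k₁)/2) ≠ 0`,
its second zero `kt` (TZ) and `ν > 0`; write `s₂ = sin((k₂−k₃)/2)`, `t = sin((k₂−kt)/2)`.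
* POINTWISE (`fibreDomination_alg`): `Φ² ≤ (|a|+16|b|)²`, `(∏ω)² ≥ ω₂⁴` (FIN file), `[f]² ≤ K²s_p²s₂²`
  (BM), `Ω² ≥ m²s_p²s₂²t²` (TZ) and `x ↦ ν/(x+ν²)` antitone give
  `integrand ≤ C·s_p²·s₂²ν/(m²s_p²s₂²t² + ν²) ≤ C·s_p²·ν/((m|s_p|)²t² + ν²)` (the last step is
  monotonicity of `Y ↦ Yν/(PY+ν²)` on `0 ≤ Y = s₂² ≤ 1`).
* KERNEL (`fibreDomination_kernel_integral_le`): for `a₀, ν > 0`,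
  `∫_{(−π,π]} ν/(a₀² sin²((k₂−kt)/2) + ν²) dk₂ ≤ π²/a₀` uniformly in `kt`: by `2π`-periodicity the
  integral is `∫_{−π}^{π} ν/(a₀² sin²(u/2) + ν²) du` (`Function.Periodic.intervalIntegral_add_eq`), Jordan's
  inequality `|u| ≤ π|sin(u/2)|` on `[−π, π]` (`bracketModulus_abs_le_pi_mul_abs_sin_half`, BM file)
  bounds the integrand by the Cauchy kernel `π²ν/(a₀²u² + π²ν²)`, whose primitive
  `(π/a₀)·arctan(a₀u/(πν))` has total variation `< (π/a₀)·π` (`Real.arctan ∈ (−π/2, π/2)`).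
* INTEGRAL: the dominating function is continuous, hence integrable on the cell, and the integrand is
  non-negative, so `MeasureTheory.integral_mono_of_nonneg` applies (no integrability of the integrand is
  needed); with `a₀ = m|s_p|` the bound is `C s_p²·π²/(m|s_p|) = C π²|s_p|/m ≤ C π²/m = M`.
-/

noncomputable section

open Real Set MeasureTheory

namespace Summit.AtomisticToContinuum.FouriersLaw.Theorems.MourreDissolution

open Literature.MathematicalPhysics.KineticTheory.PhononBoltzmann

/-! ### 1. The pointwise bound (ordered-field algebra) -/

/-- Algebraic core of the pointwise domination: if `0 ≤ V ≤ A`, `|B| ≤ K|s_p s₂|`,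
`m|s_p s₂ t| ≤ |Ω|` with `m, ν > 0` and `|s₂| ≤ 1`, then
`V·B²·ν/(Ω²+ν²) ≤ A K² s_p² · ν/((m|s_p|)² t² + ν²)`
(`B² ≤ K²s_p²s₂²`, `ν/(Ω²+ν²) ≤ ν/(m²s_p²s₂²t²+ν²)`, and `s₂²ν/(m²s_p²s₂²t²+ν²) ≤ ν/(m²s_p²t²+ν²)`
because `s₂² ≤ 1`). [folklore] -/
theorem fibreDomination_alg {V A B K sp s₂ t Ω m ν : ℝ} (hV0 : 0 ≤ V) (hVA : V ≤ A)
    (hB : |B| ≤ K * |sp * s₂|) (hΩ : m * |sp * s₂ * t| ≤ |Ω|) (hm : 0 < m)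
    (hν : 0 < ν) (hs₂ : |s₂| ≤ 1) :
    V * B ^ 2 * (ν / (Ω ^ 2 + ν ^ 2)) ≤
      A * K ^ 2 * sp ^ 2 * (ν / ((m * |sp|) ^ 2 * t ^ 2 + ν ^ 2)) := by
  have hA : 0 ≤ A := hV0.trans hVA
  have hB2 : B ^ 2 ≤ K ^ 2 * (sp ^ 2 * s₂ ^ 2) := by
    have h := pow_le_pow_left₀ (abs_nonneg B) hB 2
    rw [sq_abs] at h
    calc B ^ 2 ≤ (K * |sp * s₂|) ^ 2 := h
      _ = K ^ 2 * (sp ^ 2 * s₂ ^ 2) := by rw [mul_pow, sq_abs]; ring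
  have hΩ2 : m ^ 2 * sp ^ 2 * s₂ ^ 2 * t ^ 2 ≤ Ω ^ 2 := by
    have h := pow_le_pow_left₀ (by positivity) hΩ 2
    rw [sq_abs] at h
    calc m ^ 2 * sp ^ 2 * s₂ ^ 2 * t ^ 2 = (m * |sp * s₂ * t|) ^ 2 := by rw [mul_pow, sq_abs]; ring
      _ ≤ Ω ^ 2 := h
  have hfrac : ν / (Ω ^ 2 + ν ^ 2) ≤ ν / (m ^ 2 * sp ^ 2 * s₂ ^ 2 * t ^ 2 + ν ^ 2) :=
    div_le_div_of_nonneg_left hν.le (by positivity) (by linarith)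
  have hs₂2 : s₂ ^ 2 ≤ 1 := by
    have := pow_le_pow_left₀ (abs_nonneg s₂) hs₂ 2
    rwa [sq_abs, one_pow] at this
  have hY : s₂ ^ 2 * (ν / (m ^ 2 * sp ^ 2 * s₂ ^ 2 * t ^ 2 + ν ^ 2)) ≤
      ν / ((m * |sp|) ^ 2 * t ^ 2 + ν ^ 2) := by
    rw [mul_pow, sq_abs, ← mul_div_assoc, div_le_div_iff₀ (by positivity) (by positivity)]
    have : 0 ≤ ν ^ 3 * (1 - s₂ ^ 2) := mul_nonneg (by positivity) (by linarith)
    nlinarith [this]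
  calc V * B ^ 2 * (ν / (Ω ^ 2 + ν ^ 2))
      ≤ A * (K ^ 2 * (sp ^ 2 * s₂ ^ 2)) * (ν / (m ^ 2 * sp ^ 2 * s₂ ^ 2 * t ^ 2 + ν ^ 2)) :=
        mul_le_mul (mul_le_mul hVA hB2 (sq_nonneg _) hA) hfrac (by positivity) (by positivity)
    _ = A * K ^ 2 * sp ^ 2 * (s₂ ^ 2 * (ν / (m ^ 2 * sp ^ 2 * s₂ ^ 2 * t ^ 2 + ν ^ 2))) := by ring
    _ ≤ A * K ^ 2 * sp ^ 2 * (ν / ((m * |sp|) ^ 2 * t ^ 2 + ν ^ 2)) :=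
        mul_le_mul_of_nonneg_left hY (by positivity)

/-! ### 2. The kernel integral `∫_{cell} ν/(a₀² sin²((k₂−kt)/2) + ν²) dk₂ ≤ π²/a₀` -/

/-- Jordan comparison of the periodic kernel with the Cauchy kernel on the period cell:
for `x ∈ [−π, π]`, `ν/(a₀² sin²(x/2) + ν²) ≤ π²ν/(a₀²x² + π²ν²)` (`x² ≤ π² sin²(x/2)`). [folklore] -/
theorem fibreDomination_kernel_le_cauchy {a₀ ν x : ℝ} (hν : 0 < ν) (hx : x ∈ Icc (-π) π) :
    ν / (a₀ ^ 2 * Real.sin (x / 2) ^ 2 + ν ^ 2) ≤ π ^ 2 * ν / (a₀ ^ 2 * x ^ 2 + π ^ 2 * ν ^ 2) := by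
  have hxπ : |x| ≤ π := abs_le.2 hx
  have hj := bracketModulus_abs_le_pi_mul_abs_sin_half hxπ
  have hx2 : x ^ 2 ≤ π ^ 2 * Real.sin (x / 2) ^ 2 := by
    have h := pow_le_pow_left₀ (abs_nonneg x) hj 2
    rwa [sq_abs, mul_pow, sq_abs] at h
  rw [div_le_div_iff₀ (by positivity) (by positivity)]
  have : 0 ≤ ν * a₀ ^ 2 * (π ^ 2 * Real.sin (x / 2) ^ 2 - x ^ 2) :=
    mul_nonneg (by positivity) (by linarith)
  nlinarith [this]

/-- The Cauchy kernel integrates to at most `π²/a₀` over the cell: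
`∫_{−π}^{π} π²ν/(a₀²x² + π²ν²) dx = (π/a₀)(arctan(a₀/ν) − arctan(−a₀/ν)) ≤ π²/a₀` (fundamental
theorem of calculus with the primitive `(π/a₀)·arctan(a₀x/(πν))`). [folklore] -/
theorem fibreDomination_cauchy_integral_le {a₀ ν : ℝ} (ha : 0 < a₀) (hν : 0 < ν) :
    ∫ x in (-π)..π, π ^ 2 * ν / (a₀ ^ 2 * x ^ 2 + π ^ 2 * ν ^ 2) ≤ π ^ 2 / a₀ := by
  have hF : ∀ x : ℝ, HasDerivAt (fun x : ℝ => π / a₀ * Real.arctan (a₀ / (π * ν) * x))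
      (π ^ 2 * ν / (a₀ ^ 2 * x ^ 2 + π ^ 2 * ν ^ 2)) x := by
    intro x
    have h1 : HasDerivAt (fun x : ℝ => a₀ / (π * ν) * x) (a₀ / (π * ν)) x := by
      simpa using (hasDerivAt_id x).const_mul (a₀ / (π * ν))
    have h2 := (h1.arctan).const_mul (π / a₀)
    refine h2.congr_deriv ?_
    have hπ : (π : ℝ) ≠ 0 := Real.pi_ne_zero
    field_simp
    ring
  have hcont : Continuous fun x : ℝ => π ^ 2 * ν / (a₀ ^ 2 * x ^ 2 + π ^ 2 * ν ^ 2) :=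
    continuous_const.div (by fun_prop) fun x => by positivity
  rw [intervalIntegral.integral_eq_sub_of_hasDerivAt (fun x _ => hF x)
    (hcont.intervalIntegrable _ _)]
  have h1 := Real.arctan_lt_pi_div_two (a₀ / (π * ν) * π)
  have h2 := Real.neg_pi_div_two_lt_arctan (a₀ / (π * ν) * -π)
  have hπa : 0 < π / a₀ := by positivity
  calc π / a₀ * Real.arctan (a₀ / (π * ν) * π) - π / a₀ * Real.arctan (a₀ / (π * ν) * -π)
      = π / a₀ * (Real.arctan (a₀ / (π * ν) * π) - Real.arctan (a₀ / (π * ν) * -π)) := by ring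
    _ ≤ π / a₀ * (π / 2 - -(π / 2)) := by
        apply mul_le_mul_of_nonneg_left _ hπa.le
        linarith
    _ = π ^ 2 / a₀ := by field_simp; ring

/-- **The kernel bound.** For `a₀, ν > 0` and every centre `kt`,
`∫_{(−π,π]} ν/(a₀² sin²((k₂ − kt)/2) + ν²) dk₂ ≤ π²/a₀`: the integrand is `2π`-periodic in `k₂`, so
the integral over the cell equals `∫_{−π}^{π} ν/(a₀² sin²(u/2) + ν²) du`
(`Function.Periodic.intervalIntegral_add_eq`), which is bounded through
`fibreDomination_kernel_le_cauchy` and `fibreDomination_cauchy_integral_le`. [folklore] -/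
theorem fibreDomination_kernel_integral_le {a₀ ν : ℝ} (ha : 0 < a₀) (hν : 0 < ν) (kt : ℝ) :
    ∫ k₂ in Ioc (-π) π, ν / (a₀ ^ 2 * Real.sin ((k₂ - kt) / 2) ^ 2 + ν ^ 2) ≤ π ^ 2 / a₀ := by
  set G : ℝ → ℝ := fun x => ν / (a₀ ^ 2 * Real.sin (x / 2) ^ 2 + ν ^ 2) with hG
  have hGper : Function.Periodic G (2 * π) := by
    intro x
    simp only [hG]
    rw [show (x + 2 * π) / 2 = x / 2 + π by ring, Real.sin_add_pi, neg_sq]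
  have hGcont : Continuous G :=
    continuous_const.div (by fun_prop) fun x => by positivity
  have hπ : -π ≤ π := by linarith [Real.pi_pos]
  have h1 : ∫ k₂ in Ioc (-π) π, ν / (a₀ ^ 2 * Real.sin ((k₂ - kt) / 2) ^ 2 + ν ^ 2)
      = ∫ k₂ in (-π)..π, G (k₂ - kt) := by
    rw [intervalIntegral.integral_of_le hπ]
  have h2 : ∫ k₂ in (-π)..π, G (k₂ - kt) = ∫ x in (-π)..π, G x := by
    rw [intervalIntegral.integral_comp_sub_right]
    have := hGper.intervalIntegral_add_eq (-π - kt) (-π)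
    rw [show -π - kt + 2 * π = π - kt by ring, show -π + 2 * π = π by ring] at this
    exact this
  rw [h1, h2]
  calc ∫ x in (-π)..π, G x
      ≤ ∫ x in (-π)..π, π ^ 2 * ν / (a₀ ^ 2 * x ^ 2 + π ^ 2 * ν ^ 2) := by
        apply intervalIntegral.integral_mono_on hπ (hGcont.intervalIntegrable _ _)
          ((continuous_const.div (by fun_prop) fun x => by positivity).intervalIntegrable _ _)
        intro x hx
        exact fibreDomination_kernel_le_cauchy hν hx
    _ ≤ π ^ 2 / a₀ := fibreDomination_cauchy_integral_le ha hν

/-! ### 3. The stub -/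

/-- **STUB DOM — `stub_fibreDomination`** (registered shape `TZ → BM → DOM` of the skeleton of line
`swap-odd-threshold-rigidity`, crux `EmbeddedDrudeMourre.MourreDissolution`): GIVEN the uniform
two-zero floor of the resonance function along its `k₂`-fibres (TZ) and the bracket modulus of
`2π`-periodic `C²` profiles (BM), the `k₂`-fibre Poisson integrals of the phonon collision kernel,
`∫_{(−π,π]} Φ²(∏ω)⁻²[f]²·ν/(Ω² + ν²) dk₂`, are bounded by ONE constant
`M = (|a|+16|b|)² ω₂⁻⁴ K² π²/m` for all non-degenerate fibres `(k₁, k₃)` of the cell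
(`sin((k₃−k₁)/2) ≠ 0`, `ω′(k₃) ≠ ω′(k₁)`) and all `ν > 0` — the domination needed for dominated
convergence of the Fermi-golden-rule limit `ν ↓ 0` over the fibre dictionary. [folklore] -/
theorem stub_fibreDomination :
    (∀ ω₂ : ℝ, 0 < ω₂ → ∃ m : ℝ, 0 < m ∧ ∀ k₁ k₃ : ℝ, Real.sin ((k₃ - k₁) / 2) ≠ 0 →
      groupVelocity ω₂ k₃ ≠ groupVelocity ω₂ k₁ → ∃ kt : ℝ, ∀ k₂ : ℝ,
        m * |Real.sin ((k₃ - k₁) / 2) * Real.sin ((k₂ - k₃) / 2) * Real.sin ((k₂ - kt) / 2)| ≤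
          |resonanceFn ω₂ k₁ k₂ k₃|) →
    (∀ f : ℝ → ℝ, Function.Periodic f (2 * Real.pi) → ContDiff ℝ 2 f → ∃ K : ℝ, 0 ≤ K ∧
      ∀ k₁ k₂ k₃ : ℝ, |f k₁ + f k₂ - f k₃ - f (k₁ + k₂ - k₃)| ≤
        K * |Real.sin ((k₃ - k₁) / 2) * Real.sin ((k₂ - k₃) / 2)|) →
    ∀ ω₂ a b : ℝ, 0 < ω₂ → ∀ f : ℝ → ℝ, Function.Periodic f (2 * Real.pi) → ContDiff ℝ 2 f →
      ∃ M : ℝ, ∀ k₁ k₃ : ℝ, k₁ ∈ Set.Ioc (-Real.pi) Real.pi → k₃ ∈ Set.Ioc (-Real.pi) Real.pi →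
        Real.sin ((k₃ - k₁) / 2) ≠ 0 → groupVelocity ω₂ k₃ ≠ groupVelocity ω₂ k₁ → ∀ ν : ℝ, 0 < ν →
          (∫ k₂ in Set.Ioc (-Real.pi) Real.pi,
              vertex a b k₁ k₂ k₃ ^ 2 /
                  (dispersion ω₂ k₁ * dispersion ω₂ k₂ * dispersion ω₂ k₃ * dispersion ω₂ (k₁ + k₂ - k₃)) ^ 2 *
                (f k₁ + f k₂ - f k₃ - f (k₁ + k₂ - k₃)) ^ 2 *
                (ν / (resonanceFn ω₂ k₁ k₂ k₃ ^ 2 + ν ^ 2))) ≤ M := by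
  intro hTZ hBM ω₂ a b hω f hf hf2
  obtain ⟨m, hm, hfl⟩ := hTZ ω₂ hω
  obtain ⟨K, -, hB⟩ := hBM f hf hf2
  refine ⟨(|a| + 16 * |b|) ^ 2 / ω₂ ^ 4 * K ^ 2 * (π ^ 2 / m), ?_⟩
  intro k₁ k₃ _ _ hsp hv ν hν
  obtain ⟨kt, hkt⟩ := hfl k₁ k₃ hsp hv
  have ha₀ : 0 < m * |Real.sin ((k₃ - k₁) / 2)| := mul_pos hm (abs_pos.2 hsp)
  -- the dominating function `g = C·s_p²·ν/((m|s_p|)² sin²((k₂−kt)/2) + ν²)` is continuous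
  have hkcont : Continuous fun k₂ : ℝ =>
      ν / ((m * |Real.sin ((k₃ - k₁) / 2)|) ^ 2 * Real.sin ((k₂ - kt) / 2) ^ 2 + ν ^ 2) :=
    continuous_const.div (by fun_prop) fun x => by positivity
  have hgint : IntegrableOn (fun k₂ : ℝ => (|a| + 16 * |b|) ^ 2 / ω₂ ^ 4 * K ^ 2 *
      Real.sin ((k₃ - k₁) / 2) ^ 2 *
      (ν / ((m * |Real.sin ((k₃ - k₁) / 2)|) ^ 2 * Real.sin ((k₂ - kt) / 2) ^ 2 + ν ^ 2)))
      (Ioc (-π) π) :=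
    (continuous_const.mul hkcont).integrableOn_Ioc
  -- pointwise domination and non-negativity of the integrand
  have hptw : ∀ k₂ : ℝ,
      vertex a b k₁ k₂ k₃ ^ 2 /
            (dispersion ω₂ k₁ * dispersion ω₂ k₂ * dispersion ω₂ k₃ * dispersion ω₂ (k₁ + k₂ - k₃)) ^ 2 *
          (f k₁ + f k₂ - f k₃ - f (k₁ + k₂ - k₃)) ^ 2 *
          (ν / (resonanceFn ω₂ k₁ k₂ k₃ ^ 2 + ν ^ 2)) ≤
        (|a| + 16 * |b|) ^ 2 / ω₂ ^ 4 * K ^ 2 * Real.sin ((k₃ - k₁) / 2) ^ 2 *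
          (ν / ((m * |Real.sin ((k₃ - k₁) / 2)|) ^ 2 * Real.sin ((k₂ - kt) / 2) ^ 2 + ν ^ 2)) := by
    intro k₂
    refine fibreDomination_alg (by positivity) ?_ (hB k₁ k₂ k₃) (hkt k₂) hm hν
      (Real.abs_sin_le_one _)
    exact div_le_div₀ (by positivity) (formFiniteSmooth_vertex_sq_le a b k₁ k₂ k₃) (by positivity)
      (formFiniteSmooth_pow_four_le_prod_sq hω k₁ k₂ k₃)
  have hnonneg : ∀ k₂ : ℝ, 0 ≤
      vertex a b k₁ k₂ k₃ ^ 2 /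
            (dispersion ω₂ k₁ * dispersion ω₂ k₂ * dispersion ω₂ k₃ * dispersion ω₂ (k₁ + k₂ - k₃)) ^ 2 *
          (f k₁ + f k₂ - f k₃ - f (k₁ + k₂ - k₃)) ^ 2 *
          (ν / (resonanceFn ω₂ k₁ k₂ k₃ ^ 2 + ν ^ 2)) := fun k₂ => by positivity
  -- integrate
  calc (∫ k₂ in Set.Ioc (-Real.pi) Real.pi,
          vertex a b k₁ k₂ k₃ ^ 2 /
              (dispersion ω₂ k₁ * dispersion ω₂ k₂ * dispersion ω₂ k₃ * dispersion ω₂ (k₁ + k₂ - k₃)) ^ 2 *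
            (f k₁ + f k₂ - f k₃ - f (k₁ + k₂ - k₃)) ^ 2 *
            (ν / (resonanceFn ω₂ k₁ k₂ k₃ ^ 2 + ν ^ 2)))
      ≤ ∫ k₂ in Set.Ioc (-Real.pi) Real.pi, (|a| + 16 * |b|) ^ 2 / ω₂ ^ 4 * K ^ 2 *
          Real.sin ((k₃ - k₁) / 2) ^ 2 *
          (ν / ((m * |Real.sin ((k₃ - k₁) / 2)|) ^ 2 * Real.sin ((k₂ - kt) / 2) ^ 2 + ν ^ 2)) :=
        integral_mono_of_nonneg (Filter.Eventually.of_forall hnonneg) hgint.integrable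
          (Filter.Eventually.of_forall hptw)
    _ = (|a| + 16 * |b|) ^ 2 / ω₂ ^ 4 * K ^ 2 * Real.sin ((k₃ - k₁) / 2) ^ 2 *
          ∫ k₂ in Set.Ioc (-Real.pi) Real.pi,
            ν / ((m * |Real.sin ((k₃ - k₁) / 2)|) ^ 2 * Real.sin ((k₂ - kt) / 2) ^ 2 + ν ^ 2) :=
        integral_const_mul _ _
    _ ≤ (|a| + 16 * |b|) ^ 2 / ω₂ ^ 4 * K ^ 2 * Real.sin ((k₃ - k₁) / 2) ^ 2 *
          (π ^ 2 / (m * |Real.sin ((k₃ - k₁) / 2)|)) :=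
        mul_le_mul_of_nonneg_left (fibreDomination_kernel_integral_le ha₀ hν kt) (by positivity)
    _ = (|a| + 16 * |b|) ^ 2 / ω₂ ^ 4 * K ^ 2 * (π ^ 2 / m) * |Real.sin ((k₃ - k₁) / 2)| := by
        rw [← sq_abs (Real.sin ((k₃ - k₁) / 2))]
        have hs : |Real.sin ((k₃ - k₁) / 2)| ≠ 0 := abs_ne_zero.2 hsp
        field_simp
    _ ≤ (|a| + 16 * |b|) ^ 2 / ω₂ ^ 4 * K ^ 2 * (π ^ 2 / m) * 1 :=
        mul_le_mul_of_nonneg_left (Real.abs_sin_le_one _) (by positivity)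
    _ = (|a| + 16 * |b|) ^ 2 / ω₂ ^ 4 * K ^ 2 * (π ^ 2 / m) := mul_one _

end Summit.AtomisticToContinuum.FouriersLaw.Theorems.MourreDissolution

end
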